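import Summits.QuantumFields.YangMills.Theorems.FemtoTransferGapSlabRayleigh
import Literature.MathematicalPhysics.QuantumFieldTheory.GaugeCovariantBlockMap
import HarnessLib

/-!
# Pull-back of physical zero-flux test functions along the straight-transporter block map (nested lattices `L = M·L'`)
# (crux `DyadicNestedUpper` stmt-QuantumFields-25766 of route `FemtoCutoffLadder` rev 15/16, LINE 1 of seat ym-idea-1 g4 — «the pull-back
# … preserves IsPhys»; rung R2b1 = RECORD-label femto gap; seat ym-line-sfw-p1 g10, `--supports stmt-QuantumFields-25766`)

The variational (UPPER) direction of the nested two-cutoff comparison pulls the coarse first zero-flux excitation back to the fine lattice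
`(ℤ/ML'ℤ)³` along the gauge-covariant BLOCK LINK MAP of Bałaban's averaging in block-axial gauge: the coarse link `(y, i)` of
`(ℤ/L'ℤ)³` is read as the STRAIGHT TRANSPORTER of `M` fine links from the block representative `M·y`,
`B_M(U)(y,i) = U(My, i) U(My + e_i, i) ⋯ U(My + (M−1)e_i, i)` — in the tree's vocabulary (NO new definition)

  `fun e : Edge 3 L' => transport U (torusBlockCorner M L' e.1) (List.replicate M e.2)`,

the link part of `Literature.….GaugeCovariantBlockMap.central` written for the spatial three-torus.  This file proves:
* §1 path combinatorics of the straight paths (`mem_pathEdges_replicate`, the corner arithmetic on `ZMod (M·L')`): the FIRST link of the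
  path of `(y,i)` is `(My, i)`; every LATER link `(My + (t+1)e_i, i)` has `i`-coordinate `M·y_i + t + 1 ∈ [1, ML')`, hence is neither a block
  representative link nor a twisted link;
* §2 ★ `blockLink_gaugeTransform`: `B_M(U^g) = (B_M U)^{g ∘ (y ↦ My)}` (telescoping, `transport_gaugeTransform`);
  ★ `blockLink_twist`: `B_M(twist_k^z U) = twist_k^z (B_M U)` for EVERY `z` (a straight path in direction `i ≠ k` carries no twisted link;
  in direction `k` exactly its first link is twisted, and only when `y_k = 0`); `continuous_blockLink`;
* §3 ★★ `IsPhys.comp_blockLink`: `φ` physical on the coarse torus ⟹ `φ ∘ B_M` physical on the fine torus (bounded, measurable, gauge- and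
  twist-invariant) — the admissibility half of the pull-back trial function of 25766.  (The `L²`-isometry half — `B_M` pushes the fine
  product Haar measure to the coarse one — is the companion file `…DyadicNestedUpperPushforward.lean`.)

HONEST FRAMING: lattice combinatorics and bookkeeping for ANY compact group `G`; no spectral statement; R2b1 is a RECORD rung — nothing here
concerns infinite volume, the continuum, or the Clay Yang–Mills mass gap.  No definitions, no named facts, no `sorry`.
References: T. Bałaban, CMP 95 (1984) 17, §1 (1.4)–(1.7) (block link variables, axial gauge) [cite: Balaban1984Propagators, §1 (1.5)];
T. Bałaban, CMP 98 (1985) 17 (averaging operations for lattice gauge theories) [cite: Balaban1985Averaging].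
-/

set_option autoImplicit false

noncomputable section

open MeasureTheory Filter Topology Real
open Literature.MathematicalPhysics.QuantumFieldTheory
open Literature.MathematicalPhysics.QuantumLattice

namespace Summit.QuantumFields.YangMills.Theorems.FemtoTransferGap

namespace BlockPullback

variable {M L' : ℕ} {G : Type*}

/-! ## §1 Straight paths from block representatives -/

/-- The edges of the straight path of `n` steps in direction `i` from `c` are `(c + t·e_i, i)`, `t < n`. [folklore] -/
theorem mem_pathEdges_replicate {d L : ℕ} (c : Site d L) (i : Fin d) (n : ℕ) (e : Edge d L) :
    e ∈ pathEdges c (List.replicate n i) ↔ ∃ t : ℕ, t < n ∧ e = (c + Pi.single i ((t : ℕ) : ZMod L), i) := by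
  induction n generalizing c with
  | zero => simp [pathEdges]
  | succ n ih =>
    rw [List.replicate_succ]
    simp only [pathEdges, List.mem_cons, ih]
    have hstep : ∀ t : ℕ, Site.shift c i + Pi.single i ((t : ℕ) : ZMod L) = c + Pi.single i (((t + 1 : ℕ) : ℕ) : ZMod L) := by
      intro t
      rw [Site.shift, add_assoc, ← Pi.single_add, Nat.cast_succ, add_comm (1 : ZMod L)]
    constructor
    · rintro (rfl | ⟨t, ht, rfl⟩)
      · exact ⟨0, Nat.succ_pos n, by simp⟩
      · exact ⟨t + 1, Nat.succ_lt_succ ht, by rw [hstep]⟩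
    · rintro ⟨t, ht, rfl⟩
      rcases t with _ | t
      · exact Or.inl (by simp)
      · exact Or.inr ⟨t, Nat.lt_of_succ_lt_succ ht, by rw [hstep]⟩

/-- The transporter along a path depends only on the links of the path. [folklore] -/
theorem transport_congr [Monoid G] {d L : ℕ} {U V : GaugeConfig d L G} {c : Site d L} {is : List (Fin d)}
    (h : ∀ e ∈ pathEdges c is, U e = V e) : transport U c is = transport V c is := by
  unfold transport
  rw [List.map_congr_left h]

variable [NeZero M] [NeZero L']

omit [NeZero M] in
/-- The `i`-coordinate of the site `My + t·e_i` of the fine torus is `M·y_i + t` (for `t < M`, no wrap-around). [folklore] -/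
theorem val_corner_add_single (y : Site 3 L') (i : Fin 3) {t : ℕ} (ht : t < M) :
    ((torusBlockCorner M L' y + Pi.single i ((t : ℕ) : ZMod (M * L')) : Site 3 (M * L')) i).val = M * (y i).val + t := by
  have hlt : M * (y i).val + t < M * L' := by
    have h1 : (y i).val + 1 ≤ L' := ZMod.val_lt (y i)
    calc M * (y i).val + t < M * (y i).val + M := by omega
      _ = M * ((y i).val + 1) := by ring
      _ ≤ M * L' := Nat.mul_le_mul_left M h1
  simp only [Pi.add_apply, Pi.single_eq_same, torusBlockCorner]
  rw [← Nat.cast_add, ZMod.val_natCast_of_lt hlt]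

/-- A LATER link of a straight path from a representative is not a representative site: `M ∤ M·y_i + t` for `0 < t < M`, whereas every
coordinate of a representative `My'` is a multiple of `M`. [folklore] -/
theorem corner_add_single_ne_corner (y y' : Site 3 L') (i : Fin 3) {t : ℕ} (ht0 : 0 < t) (ht : t < M) :
    torusBlockCorner M L' y + Pi.single i ((t : ℕ) : ZMod (M * L')) ≠ torusBlockCorner M L' y' := by
  intro h
  have h1 : ((torusBlockCorner M L' y + Pi.single i ((t : ℕ) : ZMod (M * L')) : Site 3 (M * L')) i).val =
      ((torusBlockCorner M L' y') i).val := by rw [h]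
  rw [val_corner_add_single y i ht] at h1
  have hM : 0 < M := Nat.pos_of_ne_zero (NeZero.ne M)
  have hlt' : M * (y' i).val < M * L' := Nat.mul_lt_mul_of_pos_left (ZMod.val_lt (y' i)) hM
  have h2 : ((torusBlockCorner M L' y') i).val = M * (y' i).val := by
    simp only [torusBlockCorner, ZMod.val_natCast_of_lt hlt']
  rw [h2] at h1
  have h3 : (M * (y i).val + t) % M = (M * (y' i).val) % M := by rw [h1]
  rw [Nat.mul_add_mod, Nat.mul_mod_right, Nat.mod_eq_of_lt ht] at h3
  omega

omit [NeZero M] in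
/-- The `i`-coordinate of a later link `My + t·e_i` (`0 < t < M`) is non-zero. [folklore] -/
theorem corner_add_single_apply_ne_zero (y : Site 3 L') (i : Fin 3) {t : ℕ} (ht0 : 0 < t) (ht : t < M) :
    (torusBlockCorner M L' y + Pi.single i ((t : ℕ) : ZMod (M * L')) : Site 3 (M * L')) i ≠ 0 := by
  intro h
  have h1 := congrArg ZMod.val h
  rw [val_corner_add_single y i ht, ZMod.val_zero] at h1
  omega

/-- The `i`-coordinate of the representative `My` vanishes iff `y_i = 0`. [folklore] -/
theorem corner_apply_eq_zero_iff (y : Site 3 L') (i : Fin 3) : torusBlockCorner M L' y i = 0 ↔ y i = 0 := by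
  have hM : 0 < M := Nat.pos_of_ne_zero (NeZero.ne M)
  have hlt : M * (y i).val < M * L' := Nat.mul_lt_mul_of_pos_left (ZMod.val_lt (y i)) hM
  constructor
  · intro h
    have h1 := congrArg ZMod.val h
    simp only [torusBlockCorner, ZMod.val_natCast_of_lt hlt, ZMod.val_zero] at h1
    rcases Nat.mul_eq_zero.1 h1 with h2 | h2
    · exact absurd h2 hM.ne'
    · exact (ZMod.val_eq_zero _).1 h2
  · intro h
    simp only [torusBlockCorner, h, ZMod.val_zero, mul_zero, Nat.cast_zero]

/-! ## §2 The block link map: gauge covariance, twist compatibility, continuity -/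

omit [NeZero M] in
/-- ★ **Gauge covariance of the block link map**: `B_M(U^g) = (B_M U)^{g ∘ (y ↦ My)}`. [cite: Balaban1984Propagators, §1 (1.7)] -/
theorem blockLink_gaugeTransform [Group G] (g : Site 3 (M * L') → G) (U : GaugeConfig 3 (M * L') G) :
    (fun e : Edge 3 L' => transport (gaugeTransform g U) (torusBlockCorner M L' e.1) (List.replicate M e.2)) =
      gaugeTransform (fun y : Site 3 L' => g (torusBlockCorner M L' y))
        (fun e : Edge 3 L' => transport U (torusBlockCorner M L' e.1) (List.replicate M e.2)) := by
  funext e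
  simp only [gaugeTransform]
  rw [transport_gaugeTransform, pathEnd_torusBlockCorner_replicate]

omit [NeZero M] [NeZero L'] in
/-- Splitting the straight transporter after its first link. [folklore] -/
theorem transport_replicate_succ [Monoid G] {d L : ℕ} (U : GaugeConfig d L G) (c : Site d L) (i : Fin d) (m : ℕ) :
    transport U c (List.replicate (m + 1) i) = U (c, i) * transport U (Site.shift c i) (List.replicate m i) := by
  rw [List.replicate_succ, transport_cons]

omit [NeZero M] [NeZero L'] in
/-- The tail of the straight path of `(y, i)`: two configurations that agree on every link `(My + t·e_i, i)`, `0 < t < M`, have the same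
transporter along `(My + e_i, i), …, (My + (M−1)e_i, i)`. [folklore] -/
theorem transport_tail_congr [Monoid G] {U V : GaugeConfig 3 (M * L') G} (y : Site 3 L') (i : Fin 3) {m : ℕ} (hm : m + 1 = M)
    (h : ∀ e : Edge 3 (M * L'), e.2 = i → (∃ t : ℕ, 0 < t ∧ t < M ∧
      e.1 = torusBlockCorner M L' y + Pi.single i ((t : ℕ) : ZMod (M * L'))) → U e = V e) :
    transport U (Site.shift (torusBlockCorner M L' y) i) (List.replicate m i) =
      transport V (Site.shift (torusBlockCorner M L' y) i) (List.replicate m i) := by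
  refine transport_congr fun e he => ?_
  obtain ⟨t, ht, rfl⟩ := (mem_pathEdges_replicate _ i m e).1 he
  refine h _ rfl ⟨t + 1, Nat.succ_pos t, by omega, ?_⟩
  simp only
  rw [Site.shift, add_assoc, ← Pi.single_add, Nat.cast_succ, add_comm (1 : ZMod (M * L'))]

/-- ★ **Twist compatibility of the block link map**: `B_M(twist_k^z U) = twist_k^z (B_M U)` for every `z` — only the first link of the straight
path of `(y, k)` can be twisted, and it is exactly when `y_k = 0`. [cite: tHooft1979] -/
theorem blockLink_twist [Group G] (k : Fin 3) (z : G) (U : GaugeConfig 3 (M * L') G) :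
    (fun e : Edge 3 L' => transport (twist k z U) (torusBlockCorner M L' e.1) (List.replicate M e.2)) =
      twist k z (fun e : Edge 3 L' => transport U (torusBlockCorner M L' e.1) (List.replicate M e.2)) := by
  obtain ⟨m, rfl⟩ : ∃ m : ℕ, M = m + 1 := Nat.exists_eq_succ_of_ne_zero (NeZero.ne M)
  funext e
  obtain ⟨y, i⟩ := e
  -- tail links are untouched by the twist
  have htail : transport (twist k z U) (Site.shift (torusBlockCorner (m + 1) L' y) i) (List.replicate m i) =
      transport U (Site.shift (torusBlockCorner (m + 1) L' y) i) (List.replicate m i) := by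
    refine transport_tail_congr y i rfl fun e hei ⟨t, ht0, ht, he1⟩ => ?_
    simp only [twist]
    rw [if_neg]
    rintro ⟨hk, h0⟩
    have hki : k = i := hk.symm.trans hei
    rw [he1, hki] at h0
    exact corner_add_single_apply_ne_zero y i ht0 ht h0
  rw [transport_replicate_succ, htail]
  simp only [twist]
  rw [transport_replicate_succ]
  by_cases hik : i = k
  · subst hik
    by_cases hy : y i = 0
    · rw [if_pos ⟨rfl, (corner_apply_eq_zero_iff y i).2 hy⟩, if_pos ⟨rfl, hy⟩, mul_assoc]
    · rw [if_neg fun h => hy ((corner_apply_eq_zero_iff y i).1 h.2), if_neg fun h => hy h.2]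
  · rw [if_neg fun h => hik h.1, if_neg fun h => hik h.1]

omit [NeZero M] [NeZero L'] in
/-- The straight transporter is a continuous function of the configuration (finite ordered product of coordinates). [folklore] -/
theorem continuous_transport [Monoid G] [TopologicalSpace G] [ContinuousMul G] {d L : ℕ} (c : Site d L) (is : List (Fin d)) :
    Continuous fun U : GaugeConfig d L G => transport U c is := by
  induction is generalizing c with
  | nil => simp only [transport_nil]; exact continuous_const
  | cons i is ih =>
    simp only [transport_cons]
    exact (continuous_apply (c, i)).mul (ih (Site.shift c i))

omit [NeZero M] [NeZero L'] in
/-- The block link map is continuous. [folklore] -/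
theorem continuous_blockLink [Monoid G] [TopologicalSpace G] [ContinuousMul G] :
    Continuous fun U : GaugeConfig 3 (M * L') G =>
      (fun e : Edge 3 L' => transport U (torusBlockCorner M L' e.1) (List.replicate M e.2)) :=
  continuous_pi fun _ => continuous_transport _ _

/-! ## §3 The pull-back of a physical test function is physical -/

/-- ★★ **Pull-back preserves `IsPhys`**: if `φ` is a physical zero-flux test function on the coarse torus `(ℤ/L')³`, then
`U ↦ φ(B_M U)` is a physical zero-flux test function on the fine torus `(ℤ/ML')³` (gauge invariance by `blockLink_gaugeTransform`, twist
invariance by `blockLink_twist`, measurability by continuity of `B_M`). [cite: Balaban1985Averaging] -/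
theorem _root_.Summit.QuantumFields.YangMills.Theorems.FemtoTransferGap.IsPhys.comp_blockLink [Group G] [TopologicalSpace G]
    [IsTopologicalGroup G] [MeasurableSpace G] [BorelSpace G] [SecondCountableTopology G]
    {φ : GaugeConfig 3 L' G → ℝ} (hφ : IsPhys φ) :
    IsPhys fun U : GaugeConfig 3 (M * L') G =>
      φ (fun e : Edge 3 L' => transport U (torusBlockCorner M L' e.1) (List.replicate M e.2)) where
  measurable := hφ.measurable.comp continuous_blockLink.measurable
  bounded := by
    obtain ⟨C, hC⟩ := hφ.bounded
    exact ⟨C, fun U => hC _⟩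
  gaugeInv := fun g U => by
    show φ _ = φ _
    rw [blockLink_gaugeTransform, hφ.gaugeInv]
  zeroFlux := fun k z hz U => by
    show φ _ = φ _
    rw [blockLink_twist, hφ.zeroFlux k z hz]

/-! ## §4 The block link map pushes the fine product Haar measure forward to the coarse one; `L²` isometry of the pull-back -/

section Pushforward

open Classical in
/-- ★ **Left multiplication of the FIRST links.**  Multiplying the first fine link `(My, i)` of every straight path on the left by `h(y,i)`
(and no other link) multiplies the block link map on the left by `h`:  `B_M(ĥ·U) = h·B_M(U)` with
`ĥ(x, i) = h(⌊x/M⌋, i)` if `x` is a block representative, `= 1` otherwise. [folklore] -/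
theorem blockLink_firstLink_mul [Group G] (h : Edge 3 L' → G) (U : GaugeConfig 3 (M * L') G) :
    (fun e : Edge 3 L' => transport
        ((fun e' : Edge 3 (M * L') =>
          if torusBlockCorner M L' (torusBlockOf M L' e'.1) = e'.1 then h (torusBlockOf M L' e'.1, e'.2) else 1) * U)
        (torusBlockCorner M L' e.1) (List.replicate M e.2)) =
      h * (fun e : Edge 3 L' => transport U (torusBlockCorner M L' e.1) (List.replicate M e.2)) := by
  obtain ⟨m, rfl⟩ : ∃ m : ℕ, M = m + 1 := Nat.exists_eq_succ_of_ne_zero (NeZero.ne M)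
  funext e
  obtain ⟨y, i⟩ := e
  set hh : Edge 3 ((m + 1) * L') → G := fun e' =>
    if torusBlockCorner (m + 1) L' (torusBlockOf (m + 1) L' e'.1) = e'.1 then h (torusBlockOf (m + 1) L' e'.1, e'.2) else 1 with hhh
  have htail : transport (hh * U) (Site.shift (torusBlockCorner (m + 1) L' y) i) (List.replicate m i) =
      transport U (Site.shift (torusBlockCorner (m + 1) L' y) i) (List.replicate m i) := by
    refine transport_tail_congr y i rfl fun e _ ⟨t, ht0, ht, he1⟩ => ?_
    have hne : torusBlockCorner (m + 1) L' (torusBlockOf (m + 1) L' e.1) ≠ e.1 := by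
      rw [he1]; exact fun h' => corner_add_single_ne_corner y _ i ht0 ht h'.symm
    simp only [Pi.mul_apply, hhh, if_neg hne, one_mul]
  have hfirst : hh (torusBlockCorner (m + 1) L' y, i) = h (y, i) := by
    simp only [hhh, torusBlockOf_torusBlockCorner, if_true]
  simp only [Pi.mul_apply]
  rw [transport_replicate_succ, transport_replicate_succ, htail, Pi.mul_apply, hfirst, mul_assoc]

variable [Group G] [TopologicalSpace G] [IsTopologicalGroup G] [CompactSpace G] [MeasurableSpace G] [BorelSpace G]
  [SecondCountableTopology G]

omit [NeZero M] [SecondCountableTopology G] in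
/-- The a-priori measure is a left-invariant probability measure (finite product of normalised Haar measures). [folklore] -/
theorem isMulLeftInvariant_configMeasure (L : ℕ) [NeZero L] : (configMeasure G L).IsMulLeftInvariant := by
  haveI : (haarProbability G).IsMulLeftInvariant := by unfold haarProbability; infer_instance
  show (Measure.pi fun _ : Edge 3 L => haarProbability G).IsMulLeftInvariant
  infer_instance

omit [NeZero M] in
/-- **Uniqueness of the normalised Haar measure** on the compact second-countable group of configurations: two left-invariant probability
measures coincide (both are `haarMeasure ⊤`). [cite: BrockerTomDieck1985, I (5.12)] -/
theorem eq_configMeasure_of_isMulLeftInvariant (L : ℕ) [NeZero L] (ν : Measure (GaugeConfig 3 L G)) [IsProbabilityMeasure ν]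
    [ν.IsMulLeftInvariant] : ν = configMeasure G L := by
  haveI := isMulLeftInvariant_configMeasure (G := G) L
  have hν := Measure.haarMeasure_unique ν (⊤ : TopologicalSpace.PositiveCompacts (GaugeConfig 3 L G))
  have hμ := Measure.haarMeasure_unique (configMeasure G L) (⊤ : TopologicalSpace.PositiveCompacts (GaugeConfig 3 L G))
  rw [TopologicalSpace.PositiveCompacts.coe_top, measure_univ, one_smul] at hμ hν
  rw [hμ, hν]

/-- ★★ **The block link map pushes the fine a-priori measure forward to the coarse one**: `(B_M)_* μ_{ML'} = μ_{L'}` — products of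
independent Haar-distributed links are Haar distributed.  Proof by uniqueness: the image is a left-invariant probability measure, because left
multiplication by `h` downstairs is left multiplication of the first links by `ĥ` upstairs (`blockLink_firstLink_mul`), which preserves `μ_{ML'}`.
[cite: Balaban1985Averaging] -/
theorem map_blockLink_configMeasure :
    Measure.map (fun U : GaugeConfig 3 (M * L') G =>
        (fun e : Edge 3 L' => transport U (torusBlockCorner M L' e.1) (List.replicate M e.2))) (configMeasure G (M * L')) =
      configMeasure G L' := by
  classical
  set B : GaugeConfig 3 (M * L') G → GaugeConfig 3 L' G := fun U =>
    (fun e : Edge 3 L' => transport U (torusBlockCorner M L' e.1) (List.replicate M e.2)) with hBdef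
  have hBm : Measurable B := (continuous_blockLink (M := M) (L' := L') (G := G)).measurable
  haveI : IsProbabilityMeasure (Measure.map B (configMeasure G (M * L'))) := Measure.isProbabilityMeasure_map hBm.aemeasurable
  haveI := isMulLeftInvariant_configMeasure (G := G) (M * L')
  haveI : (Measure.map B (configMeasure G (M * L'))).IsMulLeftInvariant := by
    refine ⟨fun h => ?_⟩
    set hh : Edge 3 (M * L') → G := fun e' =>
      if torusBlockCorner M L' (torusBlockOf M L' e'.1) = e'.1 then h (torusBlockOf M L' e'.1, e'.2) else 1 with hhh
    have hcomp : (fun x : GaugeConfig 3 L' G => h * x) ∘ B = B ∘ fun U : GaugeConfig 3 (M * L') G => hh * U := by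
      funext U
      simp only [Function.comp_apply, hBdef, hhh]
      exact (blockLink_firstLink_mul h U).symm
    rw [Measure.map_map (measurable_const_mul h) hBm, hcomp, ← Measure.map_map hBm (measurable_const_mul hh),
      map_mul_left_eq_self]
  exact eq_configMeasure_of_isMulLeftInvariant L' _

/-- ★★ **Change of variables**: `∫ f(B_M U) dμ_{ML'}(U) = ∫ f dμ_{L'}` for measurable `f`. [folklore] -/
theorem integral_comp_blockLink {f : GaugeConfig 3 L' G → ℝ} (hf : Measurable f) :
    ∫ U, f (fun e : Edge 3 L' => transport U (torusBlockCorner M L' e.1) (List.replicate M e.2)) ∂(configMeasure G (M * L')) =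
      ∫ V, f V ∂(configMeasure G L') := by
  have hBm : Measurable fun U : GaugeConfig 3 (M * L') G =>
      (fun e : Edge 3 L' => transport U (torusBlockCorner M L' e.1) (List.replicate M e.2)) :=
    (continuous_blockLink (M := M) (L' := L') (G := G)).measurable
  rw [← map_blockLink_configMeasure (M := M) (L' := L') (G := G), integral_map hBm.aemeasurable hf.aestronglyMeasurable]

/-- ★★ **The pull-back is an `L²` isometry on physical test functions**: `⟨φ∘B_M, ψ∘B_M⟩_{ML'} = ⟨φ, ψ⟩_{L'}`. [cite: Balaban1985Averaging] -/
theorem l2_comp_blockLink {φ ψ : GaugeConfig 3 L' G → ℝ} (hφ : IsPhys φ) (hψ : IsPhys ψ) :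
    l2 (fun U : GaugeConfig 3 (M * L') G => φ (fun e : Edge 3 L' => transport U (torusBlockCorner M L' e.1) (List.replicate M e.2)))
       (fun U : GaugeConfig 3 (M * L') G => ψ (fun e : Edge 3 L' => transport U (torusBlockCorner M L' e.1) (List.replicate M e.2))) =
      l2 φ ψ := by
  unfold l2
  exact integral_comp_blockLink (M := M) (hφ.measurable.mul hψ.measurable)

end Pushforward

end BlockPullback

end Summit.QuantumFields.YangMills.Theorems.FemtoTransferGap

end
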